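import Summits.Ventures.Crystal3D.Theorems.StickyWulffConstantNoReconstructionGainAxisBarlowFilm
import Mathlib.Analysis.InnerProductSpace.Projection.Reflection
import HarnessLib

/-!
# Two Barlow families at once: the half-turn about `t`, cross-family cosets, one slot conflict

HONEST FRAMING. Part of the venture `Summits/Ventures/Crystal3D` (cell `crystal3d-full`), helper
`--supports` the crux `NoReconstructionGain` (stmt-Ventures-19144, route
`route-Ventures-StickyWulffConstant`), line `adhesion`.  Local bookkeeping for the rung
`twoFamilyBarlowFilm_adhesion` (`…TwoFamilyFilm`): films whose balls are Barlow positions of TWO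
`{111}` families of `Λ₀ = fccStacking 1 √(2/3)` — the basal one (`B = Λ₀ ∪ (Λ₀ ± w)`,
`w = barlowOffset 1`) and its image under the half-turn `R` about the bond `t = pos (1,0,0)`
(`R x = 2⟪x,t⟫ t − x`; `R e₃ = (u+v+t)/√6` is the axis of the second family, `R w = (2/3)t − w` its
letter offset; `u, v` the sites `(0,1,0), (0,0,1)`).

* `exists_halfTurn_t` and the `halfTurn_*` lemmas — `R` as a linear isometry, an involution,
  self-adjoint, `R t = t`, `R u = t − u`, `R v = t − v`, `R w = (2/3)t − w`, `R Λ₀ ⊆ Λ₀`;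
* `fcc_not_unit_of_sub_twoThirds_t`, `fcc_not_unit_of_sub_crossOffset`, `crossCoset_dist_ne_one` —
  **cosets of different families never touch**: no unit vector lies in `Λ₀ ± (w + R w)` or
  `Λ₀ ± (R w − w)` (two `mod 3`-type Diophantine impossibilities), so a ball of `Λ₀ ± w` and a ball
  of `Λ₀ ± R w` are never at distance `1`;
* `norm_sq_twinHollow_sub_halfTurn` — `‖(t − v + w) − R (t − u + w)‖² = 2/9`: an `a`-twin-hollow
  partner and a `b`-twin-hollow partner of the same lattice ball in these two slots would overlap.

WHAT THIS IS NOT: any statement about packings; rung F-C1 not moved.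
-/

noncomputable section

namespace Summit.Ventures.Crystal3D.Theorems

open Summit.Ventures.Crystal3D Finset
open Literature.MathematicalPhysics.StatisticalMechanics (barlowPos barlowStacking fccStacking
  barlowOffset constHagg haggLabel_const barlowPos_apply_zero barlowPos_apply_one barlowPos_apply_two
  orderedContacts contactDeficiency)
open scoped InnerProductSpace

/-! ### Inner products with the bond `t` -/

/-- `⟪p, t⟫ = p₀/2 + (√3/6) p₁ + √(2/3) p₂`. -/
theorem inner_t_apply (p : EuclideanSpace ℝ (Fin 3)) :
    ⟪p, barlowPos 1 (Real.sqrt (2 / 3)) constHagg 1 0 0⟫_ℝ =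
      p 0 / 2 + Real.sqrt 3 / 6 * p 1 + Real.sqrt (2 / 3) * p 2 := by
  rw [EuclideanSpace.inner_eq_star_dotProduct]
  simp only [star_trivial, dotProduct, Fin.sum_univ_three]
  simp only [barlowPos_apply_zero, barlowPos_apply_one, barlowPos_apply_two, haggLabel_const]
  push_cast
  ring

/-- `⟪pos (k,i,j), t⟫ = (i + j)/2 + k` — always a half-integer. -/
theorem inner_t_barlowPos (k i j : ℤ) :
    ⟪barlowPos 1 (Real.sqrt (2 / 3)) constHagg k i j, barlowPos 1 (Real.sqrt (2 / 3)) constHagg 1 0 0⟫_ℝ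
      = ((i : ℝ) + j) / 2 + k := by
  have h3 : Real.sqrt 3 ^ 2 = 3 := Real.sq_sqrt (by norm_num)
  have hh : Real.sqrt (2 / 3) ^ 2 = 2 / 3 := Real.sq_sqrt (by norm_num)
  rw [inner_t_apply]
  simp only [barlowPos_apply_zero, barlowPos_apply_one, barlowPos_apply_two, haggLabel_const]
  linear_combination (((j : ℝ) + k / 3) / 12) * h3 + (k : ℝ) * hh

/-- `⟪w, t⟫ = 1/3`. -/
theorem inner_t_barlowOffset :
    ⟪(barlowOffset 1 : EuclideanSpace ℝ (Fin 3)), barlowPos 1 (Real.sqrt (2 / 3)) constHagg 1 0 0⟫_ℝ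
      = 1 / 3 := by
  have h3 : Real.sqrt 3 ^ 2 = 3 := Real.sq_sqrt (by norm_num)
  rw [inner_t_apply]
  simp [barlowOffset]
  nlinarith [h3]

/-- `‖t‖ = 1`. -/
theorem norm_t : ‖(barlowPos 1 (Real.sqrt (2 / 3)) constHagg 1 0 0 : EuclideanSpace ℝ (Fin 3))‖ = 1 := by
  have h := norm_sq_barlowPos_fcc 1 0 0
  have h' : ‖(barlowPos 1 (Real.sqrt (2 / 3)) constHagg 1 0 0 : EuclideanSpace ℝ (Fin 3))‖ ^ 2 = 1 := by
    rw [h]; norm_num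
  nlinarith [norm_nonneg (barlowPos 1 (Real.sqrt (2 / 3)) constHagg 1 0 0 : EuclideanSpace ℝ (Fin 3)),
    h']

/-! ### The half-turn about `t` -/

/-- **The half-turn about the bond `t`** exists as a linear isometry: `R x = 2⟪x, t⟫ t − x`. -/
theorem exists_halfTurn_t :
    ∃ R : EuclideanSpace ℝ (Fin 3) ≃ₗᵢ[ℝ] EuclideanSpace ℝ (Fin 3),
      ∀ x, R x = (2 * ⟪x, barlowPos 1 (Real.sqrt (2 / 3)) constHagg 1 0 0⟫_ℝ) •
        barlowPos 1 (Real.sqrt (2 / 3)) constHagg 1 0 0 - x := by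
  set t : EuclideanSpace ℝ (Fin 3) := barlowPos 1 (Real.sqrt (2 / 3)) constHagg 1 0 0 with ht
  refine ⟨(ℝ ∙ t).reflection, fun x => ?_⟩
  rw [Submodule.reflection_singleton_apply, two_smul, real_inner_comm t x]
  have e : (‖t‖ : ℝ) = 1 := norm_t
  simp [e]
  module

section HalfTurn

variable (R : EuclideanSpace ℝ (Fin 3) ≃ₗᵢ[ℝ] EuclideanSpace ℝ (Fin 3))
  (hR : ∀ x, R x = (2 * ⟪x, barlowPos 1 (Real.sqrt (2 / 3)) constHagg 1 0 0⟫_ℝ) •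
    barlowPos 1 (Real.sqrt (2 / 3)) constHagg 1 0 0 - x)
include hR

/-- `R` is self-adjoint: `⟪R x, y⟫ = ⟪x, R y⟫`. -/
theorem halfTurn_inner_symm (x y : EuclideanSpace ℝ (Fin 3)) : ⟪R x, y⟫_ℝ = ⟪x, R y⟫_ℝ := by
  rw [hR x, hR y, inner_sub_left, inner_sub_right, real_inner_smul_left, real_inner_smul_right,
    real_inner_comm (barlowPos 1 (Real.sqrt (2 / 3)) constHagg 1 0 0) y]
  ring

/-- `R` is an involution. -/
theorem halfTurn_halfTurn (x : EuclideanSpace ℝ (Fin 3)) : R (R x) = x := by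
  have ht : ⟪barlowPos 1 (Real.sqrt (2 / 3)) constHagg 1 0 0,
      barlowPos 1 (Real.sqrt (2 / 3)) constHagg 1 0 0⟫_ℝ = 1 := by
    rw [real_inner_self_eq_norm_sq, norm_t, one_pow]
  rw [hR (R x), hR x, inner_sub_left, real_inner_smul_left, ht, mul_one]
  module

/-- Third coordinate of `R x`: `(R x)₂ = 2⟪x,t⟫ √(2/3) − x₂`. -/
theorem halfTurn_apply_two (x : EuclideanSpace ℝ (Fin 3)) :
    R x 2 = 2 * ⟪x, barlowPos 1 (Real.sqrt (2 / 3)) constHagg 1 0 0⟫_ℝ * Real.sqrt (2 / 3) - x 2 := by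
  rw [hR x, PiLp.sub_apply, PiLp.smul_apply, barlowPos_apply_two, smul_eq_mul]
  push_cast
  ring

/-- `R t = t`. -/
theorem halfTurn_t : R (barlowPos 1 (Real.sqrt (2 / 3)) constHagg 1 0 0) =
    barlowPos 1 (Real.sqrt (2 / 3)) constHagg 1 0 0 := by
  rw [hR, inner_t_barlowPos]; push_cast; module

/-- `R u = t − u`. -/
theorem halfTurn_u : R (barlowPos 1 (Real.sqrt (2 / 3)) constHagg 0 1 0) =
    barlowPos 1 (Real.sqrt (2 / 3)) constHagg 1 0 0 - barlowPos 1 (Real.sqrt (2 / 3)) constHagg 0 1 0 := by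
  rw [hR, inner_t_barlowPos]; push_cast; module

/-- `R v = t − v`. -/
theorem halfTurn_v : R (barlowPos 1 (Real.sqrt (2 / 3)) constHagg 0 0 1) =
    barlowPos 1 (Real.sqrt (2 / 3)) constHagg 1 0 0 - barlowPos 1 (Real.sqrt (2 / 3)) constHagg 0 0 1 := by
  rw [hR, inner_t_barlowPos]; push_cast; module

/-- `R w = (2/3) t − w`: the letter offset of the second family. -/
theorem halfTurn_barlowOffset : R (barlowOffset 1) =
    (2 / 3 : ℝ) • barlowPos 1 (Real.sqrt (2 / 3)) constHagg 1 0 0 - barlowOffset 1 := by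
  rw [hR, inner_t_barlowOffset]; module

/-- `R` maps the lattice into itself (`2⟪p, t⟫ ∈ ℤ` for `p ∈ Λ₀`). -/
theorem halfTurn_mem {p : EuclideanSpace ℝ (Fin 3)} (hp : p ∈ fccStacking 1 (Real.sqrt (2 / 3))) :
    R p ∈ fccStacking 1 (Real.sqrt (2 / 3)) := by
  obtain ⟨k, i, j, rfl⟩ := hp
  refine ⟨i + j + 2 * k - k, -i, -j, ?_⟩
  rw [hR, inner_t_barlowPos, barlowPos_fcc_linear 1 _ k, barlowPos_fcc_linear 1 _ (i + j + 2 * k - k)]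
  push_cast
  module

/-- `R` maps the lattice onto itself: the preimage form. -/
theorem halfTurn_mem_iff {p : EuclideanSpace ℝ (Fin 3)} :
    R p ∈ fccStacking 1 (Real.sqrt (2 / 3)) ↔ p ∈ fccStacking 1 (Real.sqrt (2 / 3)) := by
  refine ⟨fun h => ?_, halfTurn_mem R hR⟩
  have := halfTurn_mem R hR h
  rwa [halfTurn_halfTurn R hR] at this

/-- **The one slot conflict between the two twin-hollow triples**:
`‖(t − v + w) − R (t − u + w)‖² = 2/9` (`R (t − u + w) = (5/3)t − (t − u + w)`, and the difference is
`(t − u − v)/3`). -/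
theorem norm_sq_twinHollow_sub_halfTurn :
    ‖(barlowPos 1 (Real.sqrt (2 / 3)) constHagg 1 0 (-1) + barlowOffset 1) -
        R (barlowPos 1 (Real.sqrt (2 / 3)) constHagg 1 (-1) 0 + barlowOffset 1)‖ ^ 2 = 2 / 9 := by
  have h3 : Real.sqrt 3 ^ 2 = 3 := Real.sq_sqrt (by norm_num)
  rw [hR, inner_add_left, inner_t_barlowPos, inner_t_barlowOffset]
  set s := Real.sqrt (2 / 3) with hs
  have hh : s ^ 2 = 2 / 3 := by rw [hs]; exact Real.sq_sqrt (by norm_num)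
  rw [EuclideanSpace.real_norm_sq_eq, Fin.sum_univ_three]
  simp only [PiLp.sub_apply, PiLp.add_apply, PiLp.smul_apply, smul_eq_mul, barlowPos_apply_zero,
    barlowPos_apply_one, barlowPos_apply_two, haggLabel_const]
  simp [barlowOffset]
  linear_combination (1 / 81 : ℝ) * h3 + (1 / 9 : ℝ) * hh

end HalfTurn

/-! ### Cosets of different families never touch -/

/-- No unit vector in `Λ₀ + (2/3)t` (`= Λ₀ + (w + R w)`): with `A = 6I+3J+3K+2`, `B = 9J+3K+2`,
`C = 3K+2` the norm equation reads `3A² + B² + 8C² = 108`, which has no solution. -/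
theorem fcc_not_unit_of_sub_twoThirds_t (v : EuclideanSpace ℝ (Fin 3))
    (hv : v - (2 / 3 : ℝ) • barlowPos 1 (Real.sqrt (2 / 3)) constHagg 1 0 0 ∈
      fccStacking 1 (Real.sqrt (2 / 3))) :
    ‖v‖ ≠ 1 := by
  intro h1
  obtain ⟨K, I, J, hK⟩ := hv
  have hv' : v = barlowPos 1 (Real.sqrt (2 / 3)) constHagg K I J +
      (2 / 3 : ℝ) • barlowPos 1 (Real.sqrt (2 / 3)) constHagg 1 0 0 := by
    rw [← hK]; abel
  have h3 : Real.sqrt 3 ^ 2 = 3 := Real.sq_sqrt (by norm_num)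
  have hh : Real.sqrt (2 / 3) ^ 2 = 2 / 3 := Real.sq_sqrt (by norm_num)
  have hv0 : v 0 = (I : ℝ) + J / 2 + K / 2 + 1 / 3 := by
    rw [hv', PiLp.add_apply, PiLp.smul_apply, barlowPos_apply_zero, barlowPos_apply_zero, haggLabel_const,
      haggLabel_const, smul_eq_mul]
    push_cast; ring
  have hv1 : v 1 = Real.sqrt 3 * ((9 * (J : ℝ) + 3 * K + 2) / 18) := by
    rw [hv', PiLp.add_apply, PiLp.smul_apply, barlowPos_apply_one, barlowPos_apply_one, haggLabel_const,
      haggLabel_const, smul_eq_mul]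
    push_cast; ring
  have hv2 : v 2 = Real.sqrt (2 / 3) * ((3 * (K : ℝ) + 2) / 3) := by
    rw [hv', PiLp.add_apply, PiLp.smul_apply, barlowPos_apply_two, barlowPos_apply_two, smul_eq_mul]
    push_cast; ring
  have hnorm : ‖v‖ ^ 2 = v 0 ^ 2 + v 1 ^ 2 + v 2 ^ 2 := by
    rw [EuclideanSpace.real_norm_sq_eq, Fin.sum_univ_three]
  rw [h1, one_pow, hv0, hv1, hv2, mul_pow, mul_pow, h3, hh] at hnorm
  have hR : (3 * (6 * I + 3 * J + 3 * K + 2) ^ 2 + (9 * J + 3 * K + 2) ^ 2 + 8 * (3 * K + 2) ^ 2 : ℝ)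
      = 108 := by nlinarith [hnorm]
  have hZ : 3 * (6 * I + 3 * J + 3 * K + 2) ^ 2 + (9 * J + 3 * K + 2) ^ 2 + 8 * (3 * K + 2) ^ 2 = 108 := by
    exact_mod_cast hR
  have hKb : -1 ≤ K ∧ K ≤ 0 := by
    constructor <;> nlinarith [sq_nonneg (6 * I + 3 * J + 3 * K + 2), sq_nonneg (9 * J + 3 * K + 2),
      sq_nonneg (3 * K + 2)]
  have hJb : -1 ≤ J ∧ J ≤ 1 := by
    constructor <;> nlinarith [sq_nonneg (6 * I + 3 * J + 3 * K + 2), sq_nonneg (9 * J + 3 * K + 2),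
      sq_nonneg (3 * K + 2)]
  have hIb : -2 ≤ I ∧ I ≤ 2 := by
    constructor <;> nlinarith [sq_nonneg (6 * I + 3 * J + 3 * K + 2), sq_nonneg (9 * J + 3 * K + 2),
      sq_nonneg (3 * K + 2)]
  have key : ∀ K₁ ∈ Finset.Icc (-1 : ℤ) 0, ∀ J₁ ∈ Finset.Icc (-1 : ℤ) 1, ∀ I₁ ∈ Finset.Icc (-2 : ℤ) 2,
      3 * (6 * I₁ + 3 * J₁ + 3 * K₁ + 2) ^ 2 + (9 * J₁ + 3 * K₁ + 2) ^ 2 + 8 * (3 * K₁ + 2) ^ 2 ≠ 108 := by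
    decide
  exact key K (Finset.mem_Icc.2 hKb) J (Finset.mem_Icc.2 hJb) I (Finset.mem_Icc.2 hIb) hZ

/-- No unit vector in `Λ₀ + ((2/3)t − 2w)` (`= Λ₀ + (R w − w)`): the same equation with
`A = 6I+3J+3K−4`, `B = 9J+3K−4`. -/
theorem fcc_not_unit_of_sub_crossOffset (v : EuclideanSpace ℝ (Fin 3))
    (hv : v - ((2 / 3 : ℝ) • barlowPos 1 (Real.sqrt (2 / 3)) constHagg 1 0 0 - (2 : ℝ) • barlowOffset 1) ∈
      fccStacking 1 (Real.sqrt (2 / 3))) :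
    ‖v‖ ≠ 1 := by
  intro h1
  obtain ⟨K, I, J, hK⟩ := hv
  have hv' : v = barlowPos 1 (Real.sqrt (2 / 3)) constHagg K I J +
      ((2 / 3 : ℝ) • barlowPos 1 (Real.sqrt (2 / 3)) constHagg 1 0 0 - (2 : ℝ) • barlowOffset 1) := by
    rw [← hK]; abel
  have h3 : Real.sqrt 3 ^ 2 = 3 := Real.sq_sqrt (by norm_num)
  have hh : Real.sqrt (2 / 3) ^ 2 = 2 / 3 := Real.sq_sqrt (by norm_num)
  have hv0 : v 0 = (I : ℝ) + J / 2 + K / 2 - 2 / 3 := by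
    rw [hv', PiLp.add_apply, PiLp.sub_apply, PiLp.smul_apply, PiLp.smul_apply, barlowPos_apply_zero,
      barlowPos_apply_zero, haggLabel_const, haggLabel_const, smul_eq_mul, smul_eq_mul]
    simp [barlowOffset]; ring
  have hv1 : v 1 = Real.sqrt 3 * ((9 * (J : ℝ) + 3 * K - 4) / 18) := by
    rw [hv', PiLp.add_apply, PiLp.sub_apply, PiLp.smul_apply, PiLp.smul_apply, barlowPos_apply_one,
      barlowPos_apply_one, haggLabel_const, haggLabel_const, smul_eq_mul, smul_eq_mul]
    simp [barlowOffset]; ring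
  have hv2 : v 2 = Real.sqrt (2 / 3) * ((3 * (K : ℝ) + 2) / 3) := by
    rw [hv', PiLp.add_apply, PiLp.sub_apply, PiLp.smul_apply, PiLp.smul_apply, barlowPos_apply_two,
      barlowPos_apply_two, smul_eq_mul, smul_eq_mul]
    simp [barlowOffset]; ring
  have hnorm : ‖v‖ ^ 2 = v 0 ^ 2 + v 1 ^ 2 + v 2 ^ 2 := by
    rw [EuclideanSpace.real_norm_sq_eq, Fin.sum_univ_three]
  rw [h1, one_pow, hv0, hv1, hv2, mul_pow, mul_pow, h3, hh] at hnorm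
  have hR : (3 * (6 * I + 3 * J + 3 * K - 4) ^ 2 + (9 * J + 3 * K - 4) ^ 2 + 8 * (3 * K + 2) ^ 2 : ℝ)
      = 108 := by nlinarith [hnorm]
  have hZ : 3 * (6 * I + 3 * J + 3 * K - 4) ^ 2 + (9 * J + 3 * K - 4) ^ 2 + 8 * (3 * K + 2) ^ 2 = 108 := by
    exact_mod_cast hR
  have hKb : -1 ≤ K ∧ K ≤ 0 := by
    constructor <;> nlinarith [sq_nonneg (6 * I + 3 * J + 3 * K - 4), sq_nonneg (9 * J + 3 * K - 4),
      sq_nonneg (3 * K + 2)]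
  have hJb : -1 ≤ J ∧ J ≤ 1 := by
    constructor <;> nlinarith [sq_nonneg (6 * I + 3 * J + 3 * K - 4), sq_nonneg (9 * J + 3 * K - 4),
      sq_nonneg (3 * K + 2)]
  have hIb : -2 ≤ I ∧ I ≤ 3 := by
    constructor <;> nlinarith [sq_nonneg (6 * I + 3 * J + 3 * K - 4), sq_nonneg (9 * J + 3 * K - 4),
      sq_nonneg (3 * K + 2)]
  have key : ∀ K₁ ∈ Finset.Icc (-1 : ℤ) 0, ∀ J₁ ∈ Finset.Icc (-1 : ℤ) 1, ∀ I₁ ∈ Finset.Icc (-2 : ℤ) 3,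
      3 * (6 * I₁ + 3 * J₁ + 3 * K₁ - 4) ^ 2 + (9 * J₁ + 3 * K₁ - 4) ^ 2 + 8 * (3 * K₁ + 2) ^ 2 ≠ 108 := by
    decide
  exact key K (Finset.mem_Icc.2 hKb) J (Finset.mem_Icc.2 hJb) I (Finset.mem_Icc.2 hIb) hZ

/-- **Cosets of different families never touch.**  A ball of `Λ₀ ± w` and a ball of `Λ₀ ± w'`,
`w' = (2/3)t − w = R w`, are never at distance `1`. -/
theorem crossCoset_dist_ne_one {q x : EuclideanSpace ℝ (Fin 3)}
    (hq : q - barlowOffset 1 ∈ fccStacking 1 (Real.sqrt (2 / 3)) ∨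
      q + barlowOffset 1 ∈ fccStacking 1 (Real.sqrt (2 / 3)))
    (hx : x - ((2 / 3 : ℝ) • barlowPos 1 (Real.sqrt (2 / 3)) constHagg 1 0 0 - barlowOffset 1) ∈
        fccStacking 1 (Real.sqrt (2 / 3)) ∨
      x + ((2 / 3 : ℝ) • barlowPos 1 (Real.sqrt (2 / 3)) constHagg 1 0 0 - barlowOffset 1) ∈
        fccStacking 1 (Real.sqrt (2 / 3))) :
    dist q x ≠ 1 := by
  set t : EuclideanSpace ℝ (Fin 3) := barlowPos 1 (Real.sqrt (2 / 3)) constHagg 1 0 0 with ht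
  set w : EuclideanSpace ℝ (Fin 3) := barlowOffset 1 with hw
  intro hd
  have hn : ‖x - q‖ = 1 := by rw [← dist_eq_norm, dist_comm]; exact hd
  have hn' : ‖q - x‖ = 1 := by rw [← dist_eq_norm]; exact hd
  rcases hq with hq | hq <;> rcases hx with hx | hx
  · -- `q ∈ Λ₀ + w`, `x ∈ Λ₀ + w'`: `(x − q) − (w' − w) ∈ Λ₀`
    refine fcc_not_unit_of_sub_crossOffset (x - q) ?_ hn
    have := fcc_sub_site_mem hx hq
    rwa [show x - ((2 / 3 : ℝ) • t - w) - (q - w) = x - q - ((2 / 3 : ℝ) • t - (2 : ℝ) • w) by module]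
      at this
  · -- `q ∈ Λ₀ + w`, `x ∈ Λ₀ − w'`: `(q − x) − (2/3)t ∈ Λ₀`
    refine fcc_not_unit_of_sub_twoThirds_t (q - x) ?_ hn'
    have := fcc_sub_site_mem hq hx
    rwa [show q - w - (x + ((2 / 3 : ℝ) • t - w)) = q - x - (2 / 3 : ℝ) • t by module] at this
  · -- `q ∈ Λ₀ − w`, `x ∈ Λ₀ + w'`: `(x − q) − (2/3)t ∈ Λ₀`
    refine fcc_not_unit_of_sub_twoThirds_t (x - q) ?_ hn
    have := fcc_sub_site_mem hx hq
    rwa [show x - ((2 / 3 : ℝ) • t - w) - (q + w) = x - q - (2 / 3 : ℝ) • t by module] at this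
  · -- `q ∈ Λ₀ − w`, `x ∈ Λ₀ − w'`: `(q − x) − (w' − w) ∈ Λ₀`
    refine fcc_not_unit_of_sub_crossOffset (q - x) ?_ hn'
    have := fcc_sub_site_mem hq hx
    rwa [show q + w - (x + ((2 / 3 : ℝ) • t - w)) = q - x - ((2 / 3 : ℝ) • t - (2 : ℝ) • w) by module]
      at this

end Summit.Ventures.Crystal3D.Theorems

end
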